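import Literature.AlgebraicGeometry.AbelianSchemes.AbelianSchemeDualPair                          -- ★ D2: `AbelianSchemeOver.DualPair`
import Literature.AlgebraicGeometry.AbelianVarieties.PoincareSheafNormalised                       -- ★ p699387: `dualOf`, `phiTheta`, `mumfordSheaf`, `exists_poincareSheaf_normalised`
import Literature.AlgebraicGeometry.AbelianVarieties.PoincareSheafUniversalOfNormal                -- ★ (R3a) p706990: `exists_unique_classify_of_normal` (junction 1)
import Literature.AlgebraicGeometry.AbelianVarieties.PoincareSheafFibrewisePicZero                -- ★ (O2) p711721: `fibrewisePicZero_ofAbelianVariety_dualOf`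
import Literature.AlgebraicGeometry.Motives.PoincareUniversal.ResidualStatement                    -- ★ P00 p719686: `U_a3_residual_poincareUniversal`
import HarnessLib

/-!
# U-a3 — the dual pair of a complex abelian variety from the P44 residual (the M13 ↔ U-a junction)

Cell hodgecm-mathlib, (U)-HEAD tree edition part (A) (B-plan2 (g11) 14:26:14Z / 14:35:44Z; texts = UHead skeleton v0.16
`B-plan/probes/U-HEAD-skeleton.v0.16.B-plan2g11.lean` 9974d223 :151–:182 and :230–:339 VERBATIM; statement author B-typ02 (g10) sketch
v0.3 794e9afe, junction proofs B-plan2 (g10); hand A-p06 (g12)).  THEOREMS ONLY (the U-a3 statement is INLINED as the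
conclusion of junction 3 — no `def … : Prop`, so no named fact is booked; the UHead's HOME socket `U_a3_dualPair_ofAbelianVariety` is
its body verbatim and closes by `fun hM13 => U_a3_dualPair_ofAbelianVariety_of_residual hM13`); no instance, no `sorry`.  HC_CM is proved only modulo the printed citations until rung 0 closes.

* U-a3 (the text of the UHead socket `U_a3_dualPair_ofAbelianVariety`, B-typ02 (g10) sketch v0.3): for every complex abelian variety `A`
  and ample `Θ`: a ★ D2 dual pair `D` for `A/Spec ℂ` with `D.hat ≅ A/K(Θ)` (★ `dualOf`) and the Mumford clause
  `(1 × (φ_Θ ≫ e⁻¹))^*𝒫 ≅ Λ(𝒪(Θ))` (★ `mumfordSheaf`) — scope/locator notes of the sketch reproduced before junction 3.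
* `Motives.AbelianVariety.U_a3_residual_poincareUniversal.of_normal` / `.universal` — junctions 1–2 by elaboration (★ R3a / ★ D2).
* `Motives.AbelianVariety.U_a3_dualPair_ofAbelianVariety_of_residual : U_a3_residual_poincareUniversal → <U-a3 text>` — junction 3: ★ p699387 + ★ p711721 + the residual, field by field (`e := Iso.refl`).

## References
* [MilneAV2008] J. S. Milne, *Abelian Varieties* (2008), I §8 pp. 36–40.
* [MumfordAV1970] D. Mumford, *Abelian Varieties* (1970), §8 pp. 77–80, §10 p. 89, §13 Thm. p. 125.
* [GortzWedhorn2023] U. Görtz, T. Wedhorn, *Algebraic Geometry II* (2023), (27.41) eq. (27.41.1), Def. 27.216 (pp. 688–689), Rem. 27.217,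
  Thm./Def. 27.198 (2), Rem. 27.199 (pp. 679–681).
-/

set_option autoImplicit false

noncomputable section

open CategoryTheory CategoryTheory.Limits AlgebraicGeometry Matrix Topology
open Literature.AlgebraicGeometry.Motives (SchemeOver ComplexPoints AlgPoints specOver AbelianVariety CartierDivisor)
open Literature.AlgebraicGeometry.AbelianSchemes (PolarizedAbelianSchemeWithLevel AbelianSchemeOver)
open Literature.AlgebraicGeometry.AbelianVarieties (mumfordSheaf)


/-! ## The P44 residual gives U-a3 (junctions 1–3) -/

namespace Literature.AlgebraicGeometry.Motives.AbelianVariety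

open MonoidalCategory CartesianMonoidalCategory
open Literature.AlgebraicGeometry.AbelianSchemes Literature.AlgebraicGeometry.AbelianVarieties
  Literature.AlgebraicGeometry.Modules

/-- JUNCTION 1 (by elaboration): ★ (R3a) `exists_unique_classify_of_normal` is LITERALLY the normal-`T` case of the residual —
the residual applied at an integral normal `T` locally of finite type over `ℂ` has the type of ★ p706990's conclusion, and
conversely ★ p706990 inhabits it (so the three deleted hypotheses are the whole difference). [cite: MumfordAV1970, §8 Theorem (p. 77) and §10 (p. 89)] -/
theorem U_a3_residual_poincareUniversal.of_normal (A₀ : AbelianVariety ℂ) {Θ : CartierDivisor A₀.X.left} (hΘ : Θ.IsAmple)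
    (P : (A₀.X ⊗ (A₀.dualOf Θ hΘ).X).left.Modules) [P.IsQuasicoherent] (hP1 : HasRank P 1)
    (eP : Nonempty ((Scheme.Modules.pullback (AbelianVariety.Hom.toSchemeHom (A₀.oneProdPhiTheta hΘ))).obj P ≅
      mumfordSheaf A₀ Θ))
    (hnorm : Nonempty ((Scheme.Modules.pullback (sliceZero A₀ (A₀.dualOf Θ hΘ)).left).obj P ≅
      unitModule (A₀.dualOf Θ hΘ).X.left))
    {T : Scheme.{0}} (f : T ⟶ Spec (.of ℂ)) [IsIntegral T] [LocallyOfFiniteType f]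
    (hTn : ∀ t : T, IsIntegrallyClosed (T.presheaf.stalk t))
    (ℒ : (AbelianSchemeOver.ofAbelianVariety A₀).RigidifiedLineBundle f) (hℒ : ℒ.FibrewisePicZero) :
    ∃! g : {g : T ⟶ (A₀.dualOf Θ hΘ).X.left // g ≫ (A₀.dualOf Θ hΘ).X.hom = f},
      Nonempty ((Scheme.Modules.pullback ((AbelianSchemeOver.ofAbelianVariety A₀).baseChangeToProd
        (AbelianSchemeOver.ofAbelianVariety (A₀.dualOf Θ hΘ)) f g.1 g.2)).obj P ≅ ℒ.L) :=
  exists_unique_classify_of_normal A₀ hΘ P hP1 eP hnorm f hTn ℒ hℒ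

/-- JUNCTION 2 (by elaboration): the residual's conclusion IS the `universal` field of ★ D2 `AbelianSchemeOver.DualPair` for
`A := ofAbelianVariety A₀`, `hat := ofAbelianVariety (A₀.dualOf Θ hΘ)` and `P := 𝒫` — no transport, no cast: the product
scheme `(A₀.X ⊗ Â.X).left` of `SchemeOver ℂ` and D2's `prodLeft = pullback A.X.hom hat.X.hom` agree definitionally, and so do
the pull-back maps `1 × g` (`baseChangeToProd`).  Hence, GIVEN the residual, assembling `U_a3_dualPair_ofAbelianVariety` needs
only the remaining fields (`hasRank_one`/`rigid` ★ p699387, `fibrewisePicZero` ★ p700290 at complex points + its `Ω`-point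
form) with `e := Iso.refl` — an M-size prover-lane assembly, not done here. [cite: MilneAV2008, I §8 pp. 36–37] -/
theorem U_a3_residual_poincareUniversal.universal (h : U_a3_residual_poincareUniversal) (A₀ : AbelianVariety ℂ)
    {Θ : CartierDivisor A₀.X.left} (hΘ : Θ.IsAmple)
    (P : (A₀.X ⊗ (A₀.dualOf Θ hΘ).X).left.Modules) [P.IsQuasicoherent] (hP1 : HasRank P 1)
    (eP : Nonempty ((Scheme.Modules.pullback (AbelianVariety.Hom.toSchemeHom (A₀.oneProdPhiTheta hΘ))).obj P ≅
      mumfordSheaf A₀ Θ))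
    (hnorm : Nonempty ((Scheme.Modules.pullback (sliceZero A₀ (A₀.dualOf Θ hΘ)).left).obj P ≅
      unitModule (A₀.dualOf Θ hΘ).X.left)) :
    -- the `universal` field of `AbelianSchemeOver.DualPair`, with `A`, `hat`, `P` substituted (copied token-for-token from D2 :275)
    ∀ {T : Scheme.{0}} (f : T ⟶ Spec (.of ℂ)) (ℒ : (AbelianSchemeOver.ofAbelianVariety A₀).RigidifiedLineBundle f),
      ℒ.FibrewisePicZero →
      ∃! g : {g : T ⟶ (AbelianSchemeOver.ofAbelianVariety (A₀.dualOf Θ hΘ)).X.left //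
          g ≫ (AbelianSchemeOver.ofAbelianVariety (A₀.dualOf Θ hΘ)).X.hom = f},
        Nonempty ((Scheme.Modules.pullback ((AbelianSchemeOver.ofAbelianVariety A₀).baseChangeToProd
          (AbelianSchemeOver.ofAbelianVariety (A₀.dualOf Θ hΘ)) f g.1 g.2)).obj
            (show ((AbelianSchemeOver.ofAbelianVariety A₀).prodLeft
              (AbelianSchemeOver.ofAbelianVariety (A₀.dualOf Θ hΘ))).Modules from P) ≅ ℒ.L) :=
  fun f ℒ hℒ => h A₀ Θ hΘ P hP1 eP hnorm f ℒ hℒ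

/-! ### The U-a3 statement (UHead socket text, B-typ02 (g10) sketch v0.3 794e9afe) — reproduced for the record

**U-a3 (signature sketch v0) — the dual pair of a complex abelian variety exists, is `A/K(Θ)`, and carries the normalised
Poincaré sheaf.**  For every complex abelian variety `A` and every ample Cartier divisor `Θ` on `A` there is a dual pair
`D` (★ D2 `DualPair`: `hat`, `𝒫` of rank one, `(ε_A × 1)^*𝒫 ≅ 𝒪`, fibrewise `Pic⁰`, universal over ALL `T ⟶ Spec ℂ`) for the
abelian scheme `A/Spec ℂ`, together with an isomorphism of group schemes over `ℂ` `e : D.hat ≅ A/K(Θ)` (★ `dualOf`) under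
which `(1_A × (φ_Θ ≫ e⁻¹))^*𝒫 ≅ Λ(𝒪(Θ)) = m^*𝒪(Θ) ⊗ p₁^*𝒪(Θ)⁻¹ ⊗ p₂^*𝒪(Θ)⁻¹` (★ `mumfordSheaf`; [MumfordAV1970] §8 «there is a
sheaf `P` on `X × X̂` such that `(1 × φ_L)^*P ≅ Λ(L)`»; §13 «`X̂` does not depend on `L`» — here `Θ` stays in the binders and
the name).  SCOPE / LOCATOR NOTE (ref2 05:57:29Z; re-based v0.2 on P44): the `∃ D` inherits D2's `universal` over ALL
`T : Scheme` over `Spec ℂ` (not finite type, not reduced); [MilneAV2008]/Cornell–Silverman §10 prove it for normal `T`,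
[MumfordAV1970] §§5, 8, 13 for varieties `T` — and THAT MUCH IS NOW ★ (p706990 `exists_unique_classify_of_normal`, with p699387 /
p700290 for the other fields; LACKS (5)).  The all-`T` print a filing would cite (READ in the held text 2026-08-29):
[GortzWedhorn2023] (27.41) eq. (27.41.1) + Def. 27.216 (pp. 688–689: `X^t(T)` = rigidified line bundles on `X_T` in `X^t` at every
geometric point; the Poincaré bundle represents it over EVERY `S`-scheme `T`), Rem. 27.217 (`(id × φ_ℒ)^*𝒫 = Λ(ℒ)`), Thm./Def. 27.198
(2) + Rem. 27.199 (pp. 679–681: `X^t` is an abelian scheme, `= Pic⁰`; `φ_ℒ : X → X^t` a `K(ℒ)`-torsor, i.e. `X^t = X/K(ℒ)`), Cor. 27.162,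
over the representability engine Thm. 27.117 / 27.47 = [Kleiman2005PicardScheme] Thm. 9.4.8 + Rem. 9.5.24 (key in references.bib
since v0.2); alternatives [BoschLutkebohmertRaynaud1990, §8.4 Thm. 5], [FaltingsChai1990, I 1.9].  The residual ALONE is typed below as
`Motives.AbelianVariety.U_a3_residual_poincareUniversal`.  PROVED below from the P44 residual (★ P00 `U_a3_residual_poincareUniversal`): `U_a3_dualPair_ofAbelianVariety_of_residual` (junction 3).
[cite: MilneAV2008, I §8 (pp. 36–40: definition of `(A^∨, 𝒫)` by the universal property over all `k`-schemes; char. 0: `A^∨ = A/K(L)`)]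
[cite: MumfordAV1970, §8 (pp. 78–80) and §13 (Thm. p. 125)]
[cite: GortzWedhorn2023, (27.41) eq. (27.41.1) and Def. 27.216 (pp. 688–689), Rem. 27.217, Thm./Def. 27.198 (2) and Rem. 27.199 (pp. 679–681)]
-/

/-- JUNCTION 3 (by kernel; v0.3) — **U-a3 IS the P44 residual and nothing else**: given `U_a3_residual_poincareUniversal`,
the v0.1 statement `U_a3_dualPair_ofAbelianVariety` (token-unchanged since v0) holds, by ASSEMBLING the ★ D2 `DualPair` over
`Spec ℂ` field by field — `hat := ofAbelianVariety (A.dualOf Θ hΘ)`, `P := 𝒫` and `hasRank_one`, `rigid` from ★ p699387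
`exists_poincareSheaf_normalised` (the `rigid` clause moved from the AbelianVarieties slice `sliceZero A Â` to D2's
`unitSlice` by one `pullback.hom_ext`), `fibrewisePicZero := ★ p711721 fibrewisePicZero_ofAbelianVariety_dualOf` (B-p16, R72),
`universal :=` the residual hypothesis `h` itself (junction 2's reading; ★ p706990 / `.of_normal` is NOT used here) — with
`e := Iso.refl`, `IsMonHom (𝟙 _)`, and the Mumford clause
`(1 × (φ_Θ ≫ e⁻¹))^*𝒫 ≅ Λ(𝒪(Θ))` read off `eP` through `baseChangeToProd Â π (φ_Θ ≫ 𝟙) = (1 × φ_Θ).left` (a second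
`pullback.hom_ext`).  So after the night's relay the tree lacks, for U-a3 over `Spec ℂ`, EXACTLY the residual (P44 made a
kernel fact). [cite: MilneAV2008, I §8 pp. 36–40] [cite: MumfordAV1970, §8 (pp. 78–80) and §13 (Thm. p. 125)] -/
theorem U_a3_dualPair_ofAbelianVariety_of_residual (h : U_a3_residual_poincareUniversal) :
    ∀ (A : AbelianVariety ℂ) (Θ : CartierDivisor A.X.left) (hΘ : Θ.IsAmple),
      ∃ (D : (AbelianSchemeOver.ofAbelianVariety A).DualPair)
        (e : D.hat.X ≅ (AbelianSchemeOver.ofAbelianVariety (A.dualOf Θ hΘ)).X) (_ : IsMonHom e.hom),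
        Nonempty
          (D.pullbackP A.X.hom (AbelianVariety.Hom.toSchemeHom (A.phiTheta Θ hΘ) ≫ e.inv.left)
              (by
                rw [Category.assoc]
                exact (congrArg (AbelianVariety.Hom.toSchemeHom (A.phiTheta Θ hΘ) ≫ ·) (Over.w e.inv)).trans
                  (Over.w (A.phiTheta Θ hΘ).hom.hom.hom)) ≅
            mumfordSheaf A Θ) := by
  intro A Θ hΘ
  -- the normalised Poincaré sheaf (★ p699387)
  obtain ⟨P, hqc, hP1, ⟨eP⟩, ⟨eN⟩⟩ := exists_poincareSheaf_normalised A hΘ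
  haveI : P.IsQuasicoherent := hqc
  -- bridge 1: D2's normalisation slice `ε × 1_Â` IS the AbelianVarieties slice `(0, id) : Â → A × Â`
  have hus : (AbelianSchemeOver.ofAbelianVariety A).unitSlice (AbelianSchemeOver.ofAbelianVariety (A.dualOf Θ hΘ)) =
      (sliceZero A (A.dualOf Θ hΘ)).left := by
    apply pullback.hom_ext
    · rw [AbelianSchemeOver.unitSlice_fst]
      change _ = (sliceZero A (A.dualOf Θ hΘ)).left ≫ (CartesianMonoidalCategory.fst A.X (A.dualOf Θ hΘ).X).left
      rw [← Over.comp_left, sliceZero_fst, Hom.one_def, Over.comp_left, Over.toUnit_left]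
      rfl
    · rw [AbelianSchemeOver.unitSlice_snd]
      change _ = (sliceZero A (A.dualOf Θ hΘ)).left ≫ (CartesianMonoidalCategory.snd A.X (A.dualOf Θ hΘ).X).left
      rw [← Over.comp_left, sliceZero_snd, Over.id_left]
      rfl
  -- bridge 2: D2's `1_A × (φ_Θ ≫ 𝟙)` over `π : A → Spec ℂ` IS `(1 × φ_Θ).left`
  have hbc : ∀ (hg : (AbelianVariety.Hom.toSchemeHom (A.phiTheta Θ hΘ) ≫
        (Iso.refl (AbelianSchemeOver.ofAbelianVariety (A.dualOf Θ hΘ)).X).inv.left) ≫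
          (AbelianSchemeOver.ofAbelianVariety (A.dualOf Θ hΘ)).X.hom = A.X.hom),
      (AbelianSchemeOver.ofAbelianVariety A).baseChangeToProd (AbelianSchemeOver.ofAbelianVariety (A.dualOf Θ hΘ))
          A.X.hom (AbelianVariety.Hom.toSchemeHom (A.phiTheta Θ hΘ) ≫
            (Iso.refl (AbelianSchemeOver.ofAbelianVariety (A.dualOf Θ hΘ)).X).inv.left) hg =
        AbelianVariety.Hom.toSchemeHom (A.oneProdPhiTheta hΘ) := by
    intro hg
    apply pullback.hom_ext
    · rw [AbelianSchemeOver.baseChangeToProd_fst]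
      change _ = ((A.oneProdPhiTheta hΘ).hom.hom.hom ≫ (AbelianVariety.fst A (A.dualOf Θ hΘ)).hom.hom.hom).left
      rw [AbelianVariety.oneProdPhiTheta_comp_fst]
      rfl
    · rw [AbelianSchemeOver.baseChangeToProd_snd, Iso.refl_inv, Over.id_left]
      erw [Category.comp_id]
      change _ = ((A.oneProdPhiTheta hΘ).hom.hom.hom ≫ (AbelianVariety.snd A (A.dualOf Θ hΘ)).hom.hom.hom).left
      rw [AbelianVariety.oneProdPhiTheta_comp_snd, Over.comp_left]
      rfl
  refine ⟨AbelianSchemeOver.DualPair.mk (AbelianSchemeOver.ofAbelianVariety (A.dualOf Θ hΘ)) P hP1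
      ⟨(Scheme.Modules.pullbackCongr hus).app P ≪≫ eN⟩
      (fun Ω _ _ b => fibrewisePicZero_ofAbelianVariety_dualOf A hΘ ⟨eP⟩ Ω b)
      (fun f ℒ hℒ => @h A Θ hΘ P hqc hP1 ⟨eP⟩ ⟨eN⟩ _ f ℒ hℒ), Iso.refl _, ?_, ?_⟩
  · change IsMonHom (𝟙 _)
    infer_instance
  · change Nonempty ((Scheme.Modules.pullback ((AbelianSchemeOver.ofAbelianVariety A).baseChangeToProd
      (AbelianSchemeOver.ofAbelianVariety (A.dualOf Θ hΘ)) A.X.hom _ _)).obj P ≅ mumfordSheaf A Θ)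
    rw [hbc]
    exact ⟨eP⟩


end Literature.AlgebraicGeometry.Motives.AbelianVariety

end
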